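import Summits.BirchSwinnertonDyer.BirchSwinnertonDyer.Theorems.AdditiveKolyvaginRoadRamifiedHabitatSignLawEvenStarred
import HarnessLib

/-!
# Route `AdditiveKolyvaginRoad`, crux KS′ `LevelKolyvaginSystemsAdditive` (stmt-BirchSwinnertonDyer-21396), card `ramified-toric-habitat` —
# the ramified-habitat sign law with the habitat an imaginary quadratic FIELD `K′` of EVEN discriminant (`4 ∣ d_{K′}`)

Cell `pub/bsd-wall`, width seat `bsd-wall-akr-p2x-w3` g13; `--supports stmt-BirchSwinnertonDyer-21396` (helper). THEOREMS ONLY; no definition,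
no named fact, no `sorry`. BSD is not proved by any of this; KS′/KPA′ stay OPEN at `p² ∣ N`.

w2 g11's part 4 (`…RamifiedHabitatSignLawField`) reads the habitat `K′` of the sketch's `RamifiedToricHabitat.SignLawSupercuspidal`
(`IsImaginaryQuadratic K′`, `p ∣ d_{K′}`, `OtherBadPrimesSplit` on the primes of `M`) for ODD `d_{K′}`. Here `4 ∣ d_{K′}`:

* §6 `ramifiedHabitat_data_of_discr_of_four_dvd` — `d_{K′} = p*·D'` with `D' = 4m'` an EVEN fundamental discriminant (`m' ≡ 2, 3 (4)` squarefree),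
  `(D', M p²) = 1`, `p*·D' < 0`, for ANY `M ≠ 0` (even fundamental discriminants are `4m`, `m ≡ 2,3 (4)` squarefree — the tree's
  `isFundamentalDiscriminant_discr`; `p ∣ m`, and `m' := m/p* ≡ m (4)` as `p* ≡ 1 (4)`; the split primes do not divide `d_{K′}`, `2 ∤ M`
  because `2` ramifies, `p² ∤ d_{K′}`).
* §7 the sign laws in field form for even `d_{K′}`: `rootNumber_mul_rootNumber_twist_discr_even_eq_one_of_not_dvd` / `…_eq_neg_one_of_dvd`
  (types II/III/IV, ANY level `N = M p²`), `…_of_ge_eq_one_of_not_dvd` / `…_of_ge_eq_neg_one_of_dvd` (IV*/III*/II*, `M` squarefree),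
  `…_even_of_six` (I₀*, `M` squarefree, modulo Modularity only).

Conditional on `exists_isNewformOf` and (except I₀*) Kellock–Dokchitser's Rem. 2.2 at `p` for `E`, `E^{(p*)}`.

References: [cite: MurtyMurty1997, Ch. 6 §1] [cite: Rohrlich1993Compositio, Prop. 2(iv)] [cite: KellockDokchitser2023, Rem. 2.2]
[cite: Cohen1993, Def. 5.1.2].
-/

set_option autoImplicit false
set_option linter.dupNamespace false

noncomputable section

open scoped Classical MatrixGroups NumberTheorySymbols

open CongruenceSubgroup IsDedekindDomain IsDedekindDomain.HeightOneSpectrum NumberField Rat.HeightOneSpectrum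
  WeierstrassCurve Literature.NumberTheory.EllipticCurves Literature.NumberTheory.EllipticCurves.ModularForms
  IsDiscreteValuationRing

namespace Summit.BirchSwinnertonDyer.BirchSwinnertonDyer.Theorems.AdditiveKoly.RamifiedHabitat

/-! ## §6 The even habitat as a field: the integer data -/

section EvenField

variable {p : ℕ} [Fact p.Prime]

/-- **The habitat as a field, EVEN discriminant.** For an imaginary quadratic `K′` with `4 ∣ d_{K′} =: d`, `p ∣ d` (`p` odd, RAMIFIED) such that
every prime `q ∣ M` SPLITS in `K′` (`(d/q) = 1` for odd `q`, `d ≡ 1 (mod 8)` if `q = 2` — so in fact `2 ∤ M`), `M ≠ 0`: the cofactor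
`D' := d/p*` has `d = p*·D'`, `D' = 4m'` with `m' ≡ 2, 3 (4)` squarefree (an even fundamental discriminant), `(D', M p²) = 1`, `p*·D' < 0` —
the integer data of `…RamifiedHabitatSignLawEven`. (Fundamental discriminants: Cohen Def. 5.1.2, the tree's `isFundamentalDiscriminant_discr`;
`d < 0`: `IsImaginaryQuadratic.discr_neg`.) [cite: Cohen1993, Def. 5.1.2] -/
theorem ramifiedHabitat_data_of_discr_of_four_dvd {M : ℕ} (hp2 : p ≠ 2) (hM0 : M ≠ 0)
    (K : Type) [Field K] [NumberField K] (hK : IsImaginaryQuadratic K) (h4K : 4 ∣ NumberField.discr K)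
    (hpd : (p : ℤ) ∣ NumberField.discr K)
    (hodd : ∀ q ∈ M.primeFactors, q ≠ 2 → J(NumberField.discr K | q) = 1)
    (htwo : 2 ∣ M → NumberField.discr K % 8 = 1) :
    ∃ D' : ℤ, NumberField.discr K = (-1 : ℤ) ^ (p / 2) * p * D' ∧ 4 ∣ D' ∧ (D' / 4 % 4 = 2 ∨ D' / 4 % 4 = 3) ∧
      Squarefree (D' / 4) ∧ Int.gcd D' (M * p ^ 2 : ℕ) = 1 ∧ (-1 : ℤ) ^ (p / 2) * p * D' < 0 := by
  have hp : p.Prime := Fact.out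
  set d := NumberField.discr K with hd
  obtain ⟨hm4, hmsq⟩ : (d / 4 % 4 = 2 ∨ d / 4 % 4 = 3) ∧ Squarefree (d / 4) := by
    rcases Literature.NumberTheory.QuadraticFields.Quadratic.isFundamentalDiscriminant_discr (K := K) hK.1 with
      ⟨h1, -, -⟩ | ⟨-, hm4, hsq⟩
    · exfalso
      omega
    · exact ⟨hm4, hsq⟩
  have hdneg : d < 0 := IsImaginaryQuadratic.discr_neg hK
  set m := d / 4 with hm
  have hdm : d = 4 * m := (Int.mul_ediv_cancel' h4K).symm
  -- `M` is odd (`2` ramifies in `K′`)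
  have hM2 : ¬ 2 ∣ M := fun h2M ↦ by have h8 := htwo h2M; omega
  -- `p ∣ m`
  have hpZ : Prime (p : ℤ) := Nat.prime_iff_prime_int.mp hp
  have hpm : (p : ℤ) ∣ m := by
    have h := hpd
    rw [hdm] at h
    rcases hpZ.dvd_or_dvd h with h4 | h4m
    · exfalso
      have h4' : p ∣ 2 ^ 2 := by exact_mod_cast h4
      exact hp2 ((Nat.prime_dvd_prime_iff_eq hp Nat.prime_two).mp (hp.dvd_of_dvd_pow h4'))
    · exact h4m
  obtain ⟨t, ht⟩ := hpm
  set s : ℤ := (-1 : ℤ) ^ (p / 2) with hs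
  have hs2 : s * s = 1 := by
    rw [hs, ← pow_two, ← pow_mul]
    exact Even.neg_one_pow ⟨p / 2, by ring⟩
  have h44 : 4 * (s * t) / 4 = s * t := Int.mul_ediv_cancel_left _ (by norm_num : (4 : ℤ) ≠ 0)
  -- `p ∤ t` (squarefree `m = p t`)
  have hpt : ¬ (p : ℤ) ∣ t := by
    intro hpt
    have : (p : ℤ) * p ∣ m := by rw [ht]; exact mul_dvd_mul_left _ hpt
    exact hp.ne_one (by
      have hu := hmsq (p : ℤ) this
      exact_mod_cast Int.isUnit_iff_natAbs_eq.mp hu)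
  refine ⟨4 * (s * t), ?_, ⟨s * t, rfl⟩, ?_, ?_, ?_, ?_⟩
  · -- `d = p*·D'`
    calc d = 4 * (p * t) := by rw [hdm, ht]
      _ = (s * s) * (4 * (p * t)) := by rw [hs2, one_mul]
      _ = s * p * (4 * (s * t)) := by ring
  · -- `D'/4 = s t ≡ m (mod 4)`
    rw [h44]
    obtain ⟨c, hc⟩ := four_dvd_pStar_sub_one (p := p) hp2
    have hmod : m % 4 = (s * t) % 4 := by
      have : m = s * t + 4 * (c * (s * t)) := by
        have : m = s * t + (s * p - 1) * (s * t) := by rw [ht]; linear_combination (-(p * t)) * hs2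
        rw [← hs] at hc
        rw [this, hc]
        ring
      rw [this, Int.add_mul_emod_self_left]
    rw [← hmod]
    exact hm4
  · -- squarefree: `s t ∣ m`
    rw [h44]
    exact hmsq.squarefree_of_dvd ⟨s * p, by rw [ht]; linear_combination (-(p * t)) * hs2⟩
  · -- coprime to `M p²`
    rw [← Int.isCoprime_iff_gcd_eq_one]
    refine IsCoprime.mul_left ?_ (IsCoprime.mul_left ⟨s, 0, by rw [zero_mul, add_zero, hs2]⟩ ?_)
    · -- `(4, M p²) = 1`: `M`, `p` odd
      rw [Int.isCoprime_iff_gcd_eq_one]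
      have hodd' : Odd (M * p ^ 2) := Nat.odd_mul.mpr ⟨Nat.odd_iff.mpr (by omega), (hp.odd_of_ne_two hp2).pow⟩
      have h4c : Nat.Coprime (2 ^ 2) (M * p ^ 2) := (Nat.coprime_two_left.mpr hodd').pow_left 2
      simp only [Int.gcd, Int.natAbs_natCast]
      exact h4c
    · push_cast
      refine IsCoprime.mul_right ?_ (IsCoprime.pow_right ((Prime.coprime_iff_not_dvd hpZ).mpr hpt).symm)
      -- at the primes of `M`: they are odd and split, so they do not divide `d ⊇ t`
      rw [Int.isCoprime_iff_gcd_eq_one]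
      simp only [Int.gcd, Int.natAbs_natCast]
      refine Nat.coprime_of_dvd fun q hq hqt hqM ↦ ?_
      have hq2 : q ≠ 2 := fun h ↦ hM2 (h ▸ hqM)
      have hqZ : Prime (q : ℤ) := Nat.prime_iff_prime_int.mp hq
      haveI : NeZero q := ⟨hq.ne_zero⟩
      have hJ := hodd q (Nat.mem_primeFactors.mpr ⟨hq, hqM, hM0⟩) hq2
      have hqd : (q : ℤ) ∣ d := by
        have hqt' : (q : ℤ) ∣ t := Int.natCast_dvd.mpr hqt
        rw [hdm, ht]
        exact (hqt'.mul_left _).mul_left _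
      have h0 : J(d | q) = 0 := jacobiSym.eq_zero_iff_not_coprime.mpr (by
        intro hc
        have hc' : IsCoprime d (q : ℤ) := Int.isCoprime_iff_gcd_eq_one.mpr hc
        exact hqZ.not_unit (hc'.isUnit_of_dvd' hqd (dvd_refl _)))
      rw [h0] at hJ
      exact zero_ne_one hJ
  · -- negative
    calc s * p * (4 * (s * t)) = (s * s) * (4 * (p * t)) := by ring
      _ = d := by rw [hs2, one_mul, ← ht, ← hdm]
      _ < 0 := hdneg

/-! ## §7 The sign laws in field form, even `d_{K′}` -/

omit [Fact p.Prime] in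
/-- `M ≠ 0` when `N_E = M·p²`. [folklore] -/
private theorem cofactor_ne_zero (W : WeierstrassCurve ℚ) [W.IsElliptic] {M : ℕ} (hN : W.conductorNorm ℤ = M * p ^ 2) : M ≠ 0 :=
  fun h ↦ (W.conductorNorm_pos_holds).ne' (by rw [hN, h, zero_mul])

/-- **THE RAMIFIED-HABITAT SIGN LAW, FIELD FORM, EVEN `d_{K′}` — supercuspidal half, types II/III/IV, ANY LEVEL.** `E/ℚ` elliptic,
`N_E = M·p²` (`p ≥ 5`, `p ∤ M`, `M` arbitrary), type II/III/IV at `p` (`ord_pΔ_min = a ∈ {2,3,4}`, `ord_p c₄ > 0`, `3 ord_p c₄ ≥ ord_p Δ`),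
`e := 12/gcd(12,a)`; `K′` imaginary quadratic with `4 ∣ d_{K′}`, `p ∣ d_{K′}`, every prime of `M` split in `K′`. If `e ∤ p − 1` then
`w(E)·w(E^{(d_{K′})}) = +1`. Conditional on the Modularity Theorem and Kellock–Dokchitser's Rem. 2.2 at `p` for `E`, `E^{(p*)}`; BSD is not
proved by this. [cite: Rohrlich1993Compositio, Prop. 2(iv)] [cite: KellockDokchitser2023, Rem. 2.2] -/
theorem rootNumber_mul_rootNumber_twist_discr_even_eq_one_of_not_dvd (W : WeierstrassCurve ℚ) [W.IsElliptic]
    (hmod : exists_isNewformOf) (hF1 : W.atkinLehnerEigenvalueAt_eq_localRootNumberAt)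
    (hF1' : (W.quadraticTwist (((-1 : ℤ) ^ (p / 2) * p : ℤ) : ℚ)).atkinLehnerEigenvalueAt_eq_localRootNumberAt)
    (hp5 : 5 ≤ p) {M : ℕ} (hN : W.conductorNorm ℤ = M * p ^ 2) (hpM : ¬ p ∣ M) {a : ℕ}
    (hΔ : addVal ℤ_[p] (((W.baseChange ℚ_[p]).minimal ℤ_[p]).integralModel ℤ_[p]).Δ = a)
    (ha : a = 2 ∨ a = 3 ∨ a = 4)
    (hc₄ : addVal ℤ_[p] (((W.baseChange ℚ_[p]).minimal ℤ_[p]).integralModel ℤ_[p]).c₄ ≠ 0)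
    (hj : ¬ 3 * addVal ℤ_[p] (((W.baseChange ℚ_[p]).minimal ℤ_[p]).integralModel ℤ_[p]).c₄ <
      addVal ℤ_[p] (((W.baseChange ℚ_[p]).minimal ℤ_[p]).integralModel ℤ_[p]).Δ)
    (K : Type) [Field K] [NumberField K] (hK : IsImaginaryQuadratic K) (h4K : 4 ∣ NumberField.discr K)
    (hpd : (p : ℤ) ∣ NumberField.discr K)
    (hodd : ∀ q ∈ M.primeFactors, q ≠ 2 → J(NumberField.discr K | q) = 1)
    (htwo : 2 ∣ M → NumberField.discr K % 8 = 1)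
    (hsc : ¬ 12 / Nat.gcd a 12 ∣ p - 1) :
    W.rootNumber * (W.quadraticTwist (NumberField.discr K : ℚ)).rootNumber = 1 := by
  obtain ⟨D', hd, h4, hm4, hsq, hgcd, hneg⟩ :=
    ramifiedHabitat_data_of_discr_of_four_dvd (by omega) (cofactor_ne_zero W hN) K hK h4K hpd hodd htwo
  rw [hd] at hodd ⊢
  rw [← hN] at hgcd
  exact rootNumber_mul_rootNumber_ramifiedTwist_even_eq_one_of_not_dvd W hmod hF1 hF1' hp5 hN hpM hΔ ha hc₄ hj h4 hm4 hsq hgcd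
    hneg hodd hsc

/-- **FIELD FORM, EVEN `d_{K′}` — principal-series half, types II/III/IV, any level** (potentially good): if `e ∣ p − 1` then
`w(E)·w(E^{(d_{K′})}) = −1`. Conditional on {hmod, F1 at `p`}; BSD is not proved by this.
[cite: Rohrlich1993Compositio, Prop. 2(iv)] [cite: KellockDokchitser2023, Rem. 2.2] -/
theorem rootNumber_mul_rootNumber_twist_discr_even_eq_neg_one_of_dvd (W : WeierstrassCurve ℚ) [W.IsElliptic]
    (hmod : exists_isNewformOf) (hF1 : W.atkinLehnerEigenvalueAt_eq_localRootNumberAt)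
    (hF1' : (W.quadraticTwist (((-1 : ℤ) ^ (p / 2) * p : ℤ) : ℚ)).atkinLehnerEigenvalueAt_eq_localRootNumberAt)
    (hp5 : 5 ≤ p) {M : ℕ} (hN : W.conductorNorm ℤ = M * p ^ 2) (hpM : ¬ p ∣ M) {a : ℕ}
    (hΔ : addVal ℤ_[p] (((W.baseChange ℚ_[p]).minimal ℤ_[p]).integralModel ℤ_[p]).Δ = a)
    (ha : a = 2 ∨ a = 3 ∨ a = 4)
    (hc₄ : addVal ℤ_[p] (((W.baseChange ℚ_[p]).minimal ℤ_[p]).integralModel ℤ_[p]).c₄ ≠ 0)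
    (hj : ¬ 3 * addVal ℤ_[p] (((W.baseChange ℚ_[p]).minimal ℤ_[p]).integralModel ℤ_[p]).c₄ <
      addVal ℤ_[p] (((W.baseChange ℚ_[p]).minimal ℤ_[p]).integralModel ℤ_[p]).Δ)
    (K : Type) [Field K] [NumberField K] (hK : IsImaginaryQuadratic K) (h4K : 4 ∣ NumberField.discr K)
    (hpd : (p : ℤ) ∣ NumberField.discr K)
    (hodd : ∀ q ∈ M.primeFactors, q ≠ 2 → J(NumberField.discr K | q) = 1)
    (htwo : 2 ∣ M → NumberField.discr K % 8 = 1)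
    (hps : 12 / Nat.gcd a 12 ∣ p - 1) :
    W.rootNumber * (W.quadraticTwist (NumberField.discr K : ℚ)).rootNumber = -1 := by
  obtain ⟨D', hd, h4, hm4, hsq, hgcd, hneg⟩ :=
    ramifiedHabitat_data_of_discr_of_four_dvd (by omega) (cofactor_ne_zero W hN) K hK h4K hpd hodd htwo
  rw [hd] at hodd ⊢
  rw [← hN] at hgcd
  exact rootNumber_mul_rootNumber_ramifiedTwist_even_eq_neg_one_of_dvd W hmod hF1 hF1' hp5 hN hpM hΔ ha hc₄ hj h4 hm4 hsq hgcd
    hneg hodd hps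

/-- **FIELD FORM, EVEN `d_{K′}`, STARRED TYPES IV*/III*/II* — supercuspidal half** (`a ∈ {8,9,10}`, `M` squarefree): `e ∤ p − 1 ⟹ +1`.
Conditional on {hmod, F1 at `p`}. [cite: Rohrlich1993Compositio, Prop. 2(iv)] [cite: KellockDokchitser2023, Rem. 2.2] -/
theorem rootNumber_mul_rootNumber_twist_discr_even_of_ge_eq_one_of_not_dvd (W : WeierstrassCurve ℚ) [W.IsElliptic]
    (hmod : exists_isNewformOf) (hF1 : W.atkinLehnerEigenvalueAt_eq_localRootNumberAt)
    (hF1' : (W.quadraticTwist (((-1 : ℤ) ^ (p / 2) * p : ℤ) : ℚ)).atkinLehnerEigenvalueAt_eq_localRootNumberAt)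
    (hp5 : 5 ≤ p) {M : ℕ} (hN : W.conductorNorm ℤ = M * p ^ 2) (hM : Squarefree M) (hpM : ¬ p ∣ M) {a : ℕ}
    (hΔ : addVal ℤ_[p] (((W.baseChange ℚ_[p]).minimal ℤ_[p]).integralModel ℤ_[p]).Δ = a)
    (ha : a = 8 ∨ a = 9 ∨ a = 10)
    (hc₄ : addVal ℤ_[p] (((W.baseChange ℚ_[p]).minimal ℤ_[p]).integralModel ℤ_[p]).c₄ ≠ 0)
    (hj : ¬ 3 * addVal ℤ_[p] (((W.baseChange ℚ_[p]).minimal ℤ_[p]).integralModel ℤ_[p]).c₄ <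
      addVal ℤ_[p] (((W.baseChange ℚ_[p]).minimal ℤ_[p]).integralModel ℤ_[p]).Δ)
    (K : Type) [Field K] [NumberField K] (hK : IsImaginaryQuadratic K) (h4K : 4 ∣ NumberField.discr K)
    (hpd : (p : ℤ) ∣ NumberField.discr K)
    (hodd : ∀ q ∈ M.primeFactors, q ≠ 2 → J(NumberField.discr K | q) = 1)
    (htwo : 2 ∣ M → NumberField.discr K % 8 = 1)
    (hsc : ¬ 12 / Nat.gcd a 12 ∣ p - 1) :
    W.rootNumber * (W.quadraticTwist (NumberField.discr K : ℚ)).rootNumber = 1 := by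
  obtain ⟨D', hd, h4, hm4, hsq, hgcd, hneg⟩ :=
    ramifiedHabitat_data_of_discr_of_four_dvd (by omega) hM.ne_zero K hK h4K hpd hodd htwo
  rw [hd] at hodd ⊢
  rw [← hN] at hgcd
  exact rootNumber_mul_rootNumber_ramifiedTwist_even_of_ge_eq_one_of_not_dvd W hmod hF1 hF1' hp5 hN hM hpM hΔ ha hc₄ hj h4 hm4 hsq
    hgcd hneg hodd hsc

/-- **FIELD FORM, EVEN `d_{K′}`, STARRED TYPES — principal-series half**: `e ∣ p − 1 ⟹ −1`. Conditional on {hmod, F1 at `p`}.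
[cite: Rohrlich1993Compositio, Prop. 2(iv)] [cite: KellockDokchitser2023, Rem. 2.2] -/
theorem rootNumber_mul_rootNumber_twist_discr_even_of_ge_eq_neg_one_of_dvd (W : WeierstrassCurve ℚ) [W.IsElliptic]
    (hmod : exists_isNewformOf) (hF1 : W.atkinLehnerEigenvalueAt_eq_localRootNumberAt)
    (hF1' : (W.quadraticTwist (((-1 : ℤ) ^ (p / 2) * p : ℤ) : ℚ)).atkinLehnerEigenvalueAt_eq_localRootNumberAt)
    (hp5 : 5 ≤ p) {M : ℕ} (hN : W.conductorNorm ℤ = M * p ^ 2) (hM : Squarefree M) (hpM : ¬ p ∣ M) {a : ℕ}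
    (hΔ : addVal ℤ_[p] (((W.baseChange ℚ_[p]).minimal ℤ_[p]).integralModel ℤ_[p]).Δ = a)
    (ha : a = 8 ∨ a = 9 ∨ a = 10)
    (hc₄ : addVal ℤ_[p] (((W.baseChange ℚ_[p]).minimal ℤ_[p]).integralModel ℤ_[p]).c₄ ≠ 0)
    (hj : ¬ 3 * addVal ℤ_[p] (((W.baseChange ℚ_[p]).minimal ℤ_[p]).integralModel ℤ_[p]).c₄ <
      addVal ℤ_[p] (((W.baseChange ℚ_[p]).minimal ℤ_[p]).integralModel ℤ_[p]).Δ)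
    (K : Type) [Field K] [NumberField K] (hK : IsImaginaryQuadratic K) (h4K : 4 ∣ NumberField.discr K)
    (hpd : (p : ℤ) ∣ NumberField.discr K)
    (hodd : ∀ q ∈ M.primeFactors, q ≠ 2 → J(NumberField.discr K | q) = 1)
    (htwo : 2 ∣ M → NumberField.discr K % 8 = 1)
    (hps : 12 / Nat.gcd a 12 ∣ p - 1) :
    W.rootNumber * (W.quadraticTwist (NumberField.discr K : ℚ)).rootNumber = -1 := by
  obtain ⟨D', hd, h4, hm4, hsq, hgcd, hneg⟩ :=
    ramifiedHabitat_data_of_discr_of_four_dvd (by omega) hM.ne_zero K hK h4K hpd hodd htwo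
  rw [hd] at hodd ⊢
  rw [← hN] at hgcd
  exact rootNumber_mul_rootNumber_ramifiedTwist_even_of_ge_eq_neg_one_of_dvd W hmod hF1 hF1' hp5 hN hM hpM hΔ ha hc₄ hj h4 hm4 hsq
    hgcd hneg hodd hps

/-- **FIELD FORM, EVEN `d_{K′}`, TYPE I₀*: `w(E)·w(E^{(d_{K′})}) = −1`**, unconditional modulo the Modularity Theorem (`M` squarefree,
`ord_p Δ_min = 6`, `e = 2 ∣ p − 1`). [cite: MurtyMurty1997, Ch. 6 §1] [cite: Rohrlich1993Compositio, Prop. 2(iv)] -/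
theorem rootNumber_mul_rootNumber_twist_discr_even_of_six (W : WeierstrassCurve ℚ) [W.IsElliptic] (hmod : exists_isNewformOf)
    (hp5 : 5 ≤ p) {M : ℕ} (hN : W.conductorNorm ℤ = M * p ^ 2) (hM : Squarefree M) (hpM : ¬ p ∣ M)
    (hΔ : addVal ℤ_[p] (((W.baseChange ℚ_[p]).minimal ℤ_[p]).integralModel ℤ_[p]).Δ = (6 : ℕ))
    (hc₄ : addVal ℤ_[p] (((W.baseChange ℚ_[p]).minimal ℤ_[p]).integralModel ℤ_[p]).c₄ ≠ 0)
    (hj : ¬ 3 * addVal ℤ_[p] (((W.baseChange ℚ_[p]).minimal ℤ_[p]).integralModel ℤ_[p]).c₄ <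
      addVal ℤ_[p] (((W.baseChange ℚ_[p]).minimal ℤ_[p]).integralModel ℤ_[p]).Δ)
    (K : Type) [Field K] [NumberField K] (hK : IsImaginaryQuadratic K) (h4K : 4 ∣ NumberField.discr K)
    (hpd : (p : ℤ) ∣ NumberField.discr K)
    (hodd : ∀ q ∈ M.primeFactors, q ≠ 2 → J(NumberField.discr K | q) = 1)
    (htwo : 2 ∣ M → NumberField.discr K % 8 = 1) :
    W.rootNumber * (W.quadraticTwist (NumberField.discr K : ℚ)).rootNumber = -1 := by
  obtain ⟨D', hd, h4, hm4, hsq, hgcd, hneg⟩ :=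
    ramifiedHabitat_data_of_discr_of_four_dvd (by omega) hM.ne_zero K hK h4K hpd hodd htwo
  rw [hd] at hodd ⊢
  rw [← hN] at hgcd
  exact rootNumber_mul_rootNumber_ramifiedTwist_even_of_six W hmod hp5 hN hM hpM hΔ hc₄ hj h4 hm4 hsq hgcd hneg hodd

end EvenField

end Summit.BirchSwinnertonDyer.BirchSwinnertonDyer.Theorems.AdditiveKoly.RamifiedHabitat

end
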